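import Summits.Langlands.Langlands.Theorems.PhantomRMYoshidaResiduallyYoshidaLiftingSymplecticBlockDichotomy
import Summits.Langlands.Langlands.Theorems.PhantomRMYoshidaResiduallyYoshidaLiftingNoStablePlaneSymplectic
import Summits.Langlands.Langlands.Theorems.ResiduallyYoshidaLifting.Negative.ShLagrangianDuality
import Mathlib.LinearAlgebra.Matrix.GeneralLinearGroup.Defs
import Mathlib.LinearAlgebra.Matrix.NonsingularInverse
import HarnessLib

/-!
# A non-split residual block representation is not symplectic (stub `stub_nonsplitNotSymplectic`, G1) —
# line `sector-klingen-split`, crux `ResiduallyYoshidaLifting` (stmt-Langlands-13639)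

Stub-worker file of lead prover-line-stmt-Langlands-13639-c5-0 (2026-08-17), skeleton rev 13, sub-goal G1, namespace
`…SectorKlingenSplit.Fibre`.

**Statement (`stub_nonsplitNotSymplectic`).**  `k` a field with `2 ≠ 0`, `σ, σ' : Γ → GL₂(k)` homomorphisms such that
`σ'` is NOT a pointwise-scalar twist of a conjugate of `σ`, `B : Γ → M₂(k)` NOT a coboundary
(`B ≠ σ X - X σ'`).  Then for every `h ∈ GL₄(k)`, every alternating `G` (`Gᵀ = -G`) with `det G ≠ 0` and every scalar
function `μ : Γ → k`, the block representation `M_g = h (σ g, B g; 0, σ' g) h⁻¹` (blocks transported along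
`finSumFinEquiv`) is NOT a similitude of `G` with multipliers `μ`: `¬ ∀ g, M_gᵀ G M_g = μ g • G`.  In words: the residual
representation of a Ribet (non-split) lattice on a non-twist fibre is never `GSp₄(k)`-valued.

**Proof.**  Suppose `M_gᵀ G M_g = μ g • G` for all `g`.
* Transport to the frame `h` (`similitude_conj`, landed in `…NoStablePlaneSymplectic`): with `J₄ = hᵀ G h` (alternating,
  `det J₄ ≠ 0`) the reindexed block matrices `R_g = (σ g, B g; 0, σ' g)` satisfy `R_gᵀ J₄ R_g = μ g • J₄`; taking
  determinants, `μ g ≠ 0` (`det R_g = det σ g · det σ' g ≠ 0`).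
* In `2 × 2` blocks along `finSumFinEquiv`, `J₄ = (J₁₁, X; -Xᵀ, Y)` with `J₁₁ᵀ = -J₁₁`, `Yᵀ = -Y`
  (`fromBlocks_of_transpose_eq_neg`), and the symplectic block dichotomy T6 (`stub_symplecticBlockDichotomy`, p155154)
  applies to the block upper-triangular similitudes `(σ g, B g; 0, σ' g)`.
* Lagrangian branch: `X` invertible and `(σ g)ᵀ X (σ' g) = μ g • X`.  Multiplying by `adj(σ g)ᵀ` on the left
  (`adj(S)ᵀ Sᵀ = det S • 1`) gives `adj(σ g)ᵀ X = (μ g)⁻¹ det(σ g) • X σ' g`, and `J₂ S J₂⁻¹ = adj(S)ᵀ` on `M₂`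
  (`J₂_mul_mul_J₂inv_eq_adjugate_transpose`, landed in `…Negative.ShLagrangianDuality`), so `A = X⁻¹ J₂ ∈ GL₂(k)` has
  `A (σ g) A⁻¹ = ((μ g)⁻¹ det σ g) • σ' g` — a pointwise-scalar twist pair, excluded.
* Complemented branch: `B g = Z σ' g - σ g Z = σ g (-Z) - (-Z) σ' g` — a coboundary, excluded.

Pure Mathlib matrix algebra on top of the landed T6 and the two landed helper files; no named facts.
-/

noncomputable section

-- `Summit.Langlands.Langlands.…` (summit = sub-problem name, D-0017 layout) trips `dupNamespace` on every decl.
set_option linter.dupNamespace false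
set_option autoImplicit false

open scoped Matrix

namespace Summit.Langlands.Langlands.Cruxes.ResiduallyYoshidaLifting.SectorKlingenSplit.Fibre

open Summit.Langlands.Langlands.Theorems.ResiduallyYoshidaLifting.Negative
  (J₂_mul_J₂' J₂_mul_mul_J₂inv_eq_adjugate_transpose)

/-! ### Lagrangian duality in matrices -/

/-- If `Sᵀ X S' = μ • X` with `X` and `μ` invertible (square matrices over a field), then
`X⁻¹ adj(S)ᵀ X = (μ⁻¹ det S) • S'`: multiply by `adj(S)ᵀ` on the left and use `adj(S)ᵀ Sᵀ = (S adj S)ᵀ = det S • 1`.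
[folklore] -/
theorem inv_mul_adjugate_transpose_mul_of_lagrangian {K : Type*} [Field K] {n : Type*} [Fintype n] [DecidableEq n]
    (S S' X : Matrix n n K) (μ : K) (hX : IsUnit X.det) (hμ : μ ≠ 0) (h : Sᵀ * X * S' = μ • X) :
    X⁻¹ * S.adjugateᵀ * X = (μ⁻¹ * S.det) • S' := by
  have h1 : S.adjugateᵀ * (Sᵀ * X * S') = S.det • (X * S') := by
    rw [Matrix.mul_assoc Sᵀ, ← Matrix.mul_assoc, ← Matrix.transpose_mul, Matrix.mul_adjugate,
      Matrix.transpose_smul, Matrix.transpose_one, Matrix.smul_mul, Matrix.one_mul]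
  rw [h, Matrix.mul_smul] at h1
  have h2 : S.adjugateᵀ * X = (μ⁻¹ * S.det) • (X * S') := by
    rw [mul_smul, ← h1, smul_smul, inv_mul_cancel₀ hμ, one_smul]
  rw [Matrix.mul_assoc, h2, Matrix.mul_smul, Matrix.nonsing_inv_mul_cancel_left X _ hX]

/-- **Lagrangian duality as a twist pair.**  If `(σ g)ᵀ X (σ' g) = μ g • X` for all `g` with `X` invertible and all
`μ g ≠ 0` (`2 × 2` matrices over a field), then `A = X⁻¹ J₂ ∈ GL₂` (`J₂ = (0, 1; -1, 0)`, `A⁻¹ = J₂⁻¹ X`) conjugates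
every `σ g` to the scalar multiple `((μ g)⁻¹ det σ g) • σ' g` of `σ' g` (`J₂ S J₂⁻¹ = adj(S)ᵀ`). [folklore] -/
theorem exists_conj_eq_smul_of_lagrangian {K : Type*} [Field K] {Γ : Type*} (σ σ' : Γ → Matrix (Fin 2) (Fin 2) K)
    (X : Matrix (Fin 2) (Fin 2) K) (μ : Γ → K) (hX : IsUnit X.det) (hμ : ∀ g, μ g ≠ 0)
    (h : ∀ g, (σ g)ᵀ * X * σ' g = μ g • X) :
    ∃ A : GL (Fin 2) K, ∀ g, A.val * σ g * (A⁻¹).val = ((μ g)⁻¹ * (σ g).det) • σ' g := by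
  refine ⟨⟨X⁻¹ * !![(0 : K), 1; -1, 0], !![(0 : K), -1; 1, 0] * X, ?_, ?_⟩, fun g => ?_⟩
  · rw [Matrix.mul_assoc, ← Matrix.mul_assoc _ _ X, J₂_mul_J₂', Matrix.one_mul, Matrix.nonsing_inv_mul X hX]
  · rw [Matrix.mul_assoc, ← Matrix.mul_assoc X, Matrix.mul_nonsing_inv X hX, Matrix.one_mul]
    exact mul_eq_one_comm.mp J₂_mul_J₂'
  · show X⁻¹ * !![(0 : K), 1; -1, 0] * σ g * (!![(0 : K), -1; 1, 0] * X) = _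
    calc X⁻¹ * !![(0 : K), 1; -1, 0] * σ g * (!![(0 : K), -1; 1, 0] * X)
        = X⁻¹ * (!![(0 : K), 1; -1, 0] * σ g * !![(0 : K), -1; 1, 0]) * X := by simp only [Matrix.mul_assoc]
      _ = ((μ g)⁻¹ * (σ g).det) • σ' g := by
        rw [J₂_mul_mul_J₂inv_eq_adjugate_transpose,
          inv_mul_adjugate_transpose_mul_of_lagrangian (σ g) (σ' g) X (μ g) hX (hμ g) (h g)]

/-! ### The registered stub -/

/-- **Registered sub-goal G1 `stub_nonsplitNotSymplectic`** (crux stmt-Langlands-13639, line `sector-klingen-split`,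
skeleton rev 13): a NON-split block representation `h (σ̄, B; 0, σ̄') h⁻¹` of a NON-TWIST pair (`σ̄'` is no
pointwise-scalar twist of a conjugate of `σ̄`) preserves NO non-degenerate alternating form of `k⁴` up to any scalar
function `μ` (`char k ≠ 2`): by the symplectic block dichotomy T6 (p155154) the `σ̄`-plane would be Lagrangian — then
`A σ̄ A⁻¹ = (μ⁻¹ det σ̄) • σ̄'` for `A = X⁻¹ J₂`, a scalar twist of a conjugate — or complemented — then
`B = σ̄ (-Z) - (-Z) σ̄'`, a coboundary.  So the residual representation of a Ribet lattice is never `GSp₄(k)`-valued.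
[folklore] -/
theorem stub_nonsplitNotSymplectic :
    ∀ (k : Type) [Field k], (2 : k) ≠ 0 → ∀ (Γ : Type) [Group Γ] (σ σ' : Γ →* GL (Fin 2) k),
      (¬ ∃ g : GL (Fin 2) k, ∀ x, ∃ c : k, (g * σ x * g⁻¹).val = c • (σ' x).val) →
      ∀ (B : Γ → Matrix (Fin 2) (Fin 2) k),
      (¬ ∃ X : Matrix (Fin 2) (Fin 2) k, ∀ g, B g = (σ g).val * X - X * (σ' g).val) →
      ∀ (h : GL (Fin 4) k) (G : Matrix (Fin 4) (Fin 4) k) (μ : Γ → k), Gᵀ = -G → G.det ≠ 0 →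
      ¬ ∀ g, (h.val * Matrix.reindex finSumFinEquiv finSumFinEquiv (Matrix.fromBlocks (σ g).val (B g) 0 (σ' g).val) *
              (h⁻¹).val)ᵀ * G *
            (h.val * Matrix.reindex finSumFinEquiv finSumFinEquiv (Matrix.fromBlocks (σ g).val (B g) 0 (σ' g).val) *
              (h⁻¹).val) = μ g • G := by
  intro k _ h2 Γ _ σ σ' hnt B hB h G μ hGt hGdet hsim
  have hτ : ∀ g, IsUnit (σ g).val.det := fun g => Matrix.isUnits_det_units (σ g)
  have hhdet : h.val.det ≠ 0 := (Matrix.isUnits_det_units h).ne_zero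
  -- (1) transport to the frame `h`: the Gram matrix `J₄ = hᵀ G h` and the similitudes `R_g = (σ g, B g; 0, σ' g)`
  obtain ⟨J₄, hJ₄⟩ : ∃ J₄ : Matrix (Fin 4) (Fin 4) k, J₄ = h.valᵀ * G * h.val := ⟨_, rfl⟩
  have hJ₄det : J₄.det ≠ 0 := by
    rw [hJ₄, Matrix.det_mul, Matrix.det_mul, Matrix.det_transpose]
    exact mul_ne_zero (mul_ne_zero hhdet hGdet) hhdet
  have hconj : ∀ M : Matrix (Fin 4) (Fin 4) k, (h⁻¹).val * (h.val * M * (h⁻¹).val) * h.val = M := fun M => by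
    rw [Matrix.mul_assoc, Matrix.mul_assoc, Units.inv_mul, Matrix.mul_one, ← Matrix.mul_assoc, Units.inv_mul,
      Matrix.one_mul]
  have hsim₄ : ∀ g, (Matrix.reindex finSumFinEquiv finSumFinEquiv
        (Matrix.fromBlocks (σ g).val (B g) 0 (σ' g).val) : Matrix (Fin 4) (Fin 4) k)ᵀ * J₄ *
      Matrix.reindex finSumFinEquiv finSumFinEquiv (Matrix.fromBlocks (σ g).val (B g) 0 (σ' g).val) = μ g • J₄ :=
    fun g => by
    have e := similitude_conj h _ G (μ g) (hsim g)
    rw [hconj, ← hJ₄] at e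
    exact e
  have hRdet : ∀ g, (Matrix.reindex finSumFinEquiv finSumFinEquiv
      (Matrix.fromBlocks (σ g).val (B g) 0 (σ' g).val) : Matrix (Fin 4) (Fin 4) k).det ≠ 0 := fun g => by
    rw [Matrix.det_reindex_self, Matrix.det_fromBlocks_zero₂₁]
    exact mul_ne_zero (hτ g).ne_zero (Matrix.isUnits_det_units (σ' g)).ne_zero
  -- the multipliers are non-zero (determinants)
  have hμ : ∀ g, μ g ≠ 0 := fun g h0 => by
    have e1 := congrArg Matrix.det (hsim₄ g)
    rw [h0, zero_smul, Matrix.det_zero, Matrix.det_mul, Matrix.det_mul, Matrix.det_transpose] at e1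
    exact mul_ne_zero (mul_ne_zero (hRdet g) hJ₄det) (hRdet g) e1
  -- (2) the Gram matrix in `2 × 2` blocks along `finSumFinEquiv`
  obtain ⟨J', hJ'⟩ : ∃ J' : Matrix (Fin 2 ⊕ Fin 2) (Fin 2 ⊕ Fin 2) k,
      J' = J₄.submatrix finSumFinEquiv finSumFinEquiv := ⟨_, rfl⟩
  have hJ't : J'ᵀ = -J' := by
    rw [hJ', hJ₄, Matrix.transpose_submatrix, Matrix.transpose_mul, Matrix.transpose_mul, Matrix.transpose_transpose,
      hGt]
    simp only [Matrix.mul_neg, Matrix.neg_mul, Matrix.mul_assoc]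
    rfl
  have hJ'det : J'.det ≠ 0 := by
    rw [hJ', Matrix.det_submatrix_equiv_self]
    exact hJ₄det
  obtain ⟨hJ'blk, hJ11t, hYt⟩ := fromBlocks_of_transpose_eq_neg J' hJ't
  -- the block similitude identity
  have hsimb : ∀ g, (Matrix.fromBlocks (σ g).val (B g) 0 (σ' g).val)ᵀ * J' *
      Matrix.fromBlocks (σ g).val (B g) 0 (σ' g).val = μ g • J' := fun g => by
    have e2 : (Matrix.reindex finSumFinEquiv finSumFinEquiv
        (Matrix.fromBlocks (σ g).val (B g) 0 (σ' g).val) : Matrix (Fin 4) (Fin 4) k).submatrix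
          finSumFinEquiv finSumFinEquiv = Matrix.fromBlocks (σ g).val (B g) 0 (σ' g).val := by
      rw [Matrix.reindex_apply, Matrix.submatrix_submatrix, Equiv.symm_comp_self, Matrix.submatrix_id_id]
    rw [← e2, hJ', Matrix.transpose_submatrix, Matrix.submatrix_mul_equiv, Matrix.submatrix_mul_equiv, hsim₄ g]
    rfl
  -- (3) the symplectic block dichotomy (T6)
  rcases stub_symplecticBlockDichotomy k h2 Γ (fun g => (σ g).val) (fun g => (σ' g).val) B μ
      J'.toBlocks₁₁ J'.toBlocks₁₂ J'.toBlocks₂₂ hJ11t hYt (by rw [← hJ'blk]; exact hJ'det) hτ hμ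
      (fun g => by rw [← hJ'blk]; exact hsimb g) with ⟨-, hX, hLag⟩ | ⟨Z, hZ⟩
  · -- Lagrangian plane: `(σ, σ')` is a pointwise-scalar twist pair — excluded
    obtain ⟨A, hA⟩ :=
      exists_conj_eq_smul_of_lagrangian (fun g => (σ g).val) (fun g => (σ' g).val) J'.toBlocks₁₂ μ hX hμ hLag
    exact hnt ⟨A, fun x => ⟨(μ x)⁻¹ * (σ x).val.det, by rw [Units.val_mul, Units.val_mul]; exact hA x⟩⟩
  · -- complemented plane: `B` is a coboundary — excluded
    exact hB ⟨-Z, fun g => by rw [Matrix.mul_neg, Matrix.neg_mul, sub_neg_eq_add, neg_add_eq_sub]; exact hZ g⟩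

end Summit.Langlands.Langlands.Cruxes.ResiduallyYoshidaLifting.SectorKlingenSplit.Fibre

end
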